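import Literature.MathematicalPhysics.KineticTheory.HardSphereEulerLLN
import Literature.Analysis.FunctionSpaces.TorusLiftDerivBounds
import Literature.Analysis.FunctionSpaces.HolderNormProofs
import Mathlib.Analysis.Calculus.SmoothSeries
import Mathlib.Analysis.SpecificLimits.Normed

/-!
# Smooth statics rate for the limit density of the local Gibbs law (stub `stub_staticsSmoothRate`)

Crux `Summit.AtomisticToContinuum.HydrodynamicLimit.Theses.ImplosionDichotomy.PolynomialCompression`
(line `log-lipschitz-budget`), stub `stub_staticsSmoothRate`: for a smooth positive activity `a₀` on
`𝕋³` with profile `β = a₀ / ∫ a₀` (`profileOf`), the LLN limit density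
`rhoLim (profileOf a₀) σ = ∑_j γ_{j+1} R^{j+1} β^{j+1}` (`HardSphereEulerLLN`) is smooth whenever
`SmallDensity (profileOf a₀) σ` holds, and for every `n` there is `Cₙ = Cₙ(a₀)` with
`‖Dⁿ lift(rhoLim (profileOf a₀) σ - β)(y)‖ ≤ Cₙ σ³` for all such `σ` and all `y ∈ ℝ³`.

## Proof

The lift of `rhoLim` to `ℝ³` is the series `∑_j T_j`, `T_j = γ_{j+1} R^{j+1} (lift β)^{j+1}`. The
periodic lift of the smooth `β` has all derivatives bounded
(`Torus.IsSmooth.eSupNorm_iteratedFDeriv_lift_lt_top`), packaged as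
`Torus.HasLiftDerivBounds k β M L_k` with amplitude EXACTLY `M = sup β` (`exists_hasLiftDerivBounds`);
the Leibniz calculus `Torus.HasLiftDerivBounds.mul` gives `‖Dⁱ (lift β)^{m}‖ ≤ M^m (m L_k)ⁱ`
(`hasLiftDerivBounds_pow`), whence with `|γ_{j+1}| ≤ e (e v₁ σ³)ʲ` (`abs_clusterCoeff_le`) and
`R ≤ 2`: `‖Dᵏ T_j‖ ≤ 2 e M L_kᵏ (j+1)ᵏ θʲ`, `θ = geomRatio = 2 e M v₁ σ³ < 1`. Mathlib's
`contDiff_tsum` / `iteratedFDeriv_tsum_apply` then give smoothness and termwise differentiation;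
the zeroth term is `R · lift β` (`γ₁ = 1`), `|R - 1| ≤ 4 e θ`, and the tail `j ≥ 1` carries a factor
`θ ≤ 1/2`, so `‖Dⁿ lift(rhoLim - β)‖ ≤ 2 e M L_nⁿ (2 + ∑_j (j+2)ⁿ 2^{-j}) θ = Cₙ σ³`.
-/

namespace Summit.AtomisticToContinuum.HydrodynamicLimit.Theorems

open Set MeasureTheory Filter
open Literature.MathematicalPhysics.KineticTheory
open Literature.Analysis.FunctionSpaces
open scoped ContDiff Topology

namespace StaticsSmoothRate

/-! ## Elementary constants of the cluster expansion under `SmallDensity` -/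

/-- `θ = geomRatio P σ > 0` under `SmallDensity` (`σ, M, v₁ > 0`). [folklore] -/
theorem geomRatio_pos {P : DensityProfile} {σ : ℝ} (h : SmallDensity P σ) : 0 < geomRatio P σ := by
  have h1 := h.σ_pos
  have h2 := P.M_pos
  have h3 := v₁_pos
  unfold geomRatio ovDensity
  positivity

-- adapted from Cruxes/PolynomialCompression/Disproof.lean (cdisprove), proof of `abs_rhoLim_sub_β_le`
/-- `θ ≤ 1/2` under `SmallDensity` (from `eθ/(1-θ) < 1/2` and `e ≥ 1`). [folklore] -/
theorem geomRatio_le_half {P : DensityProfile} {σ : ℝ} (h : SmallDensity P σ) :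
    geomRatio P σ ≤ 1 / 2 := by
  have hθ0 := h.geomRatio_nonneg
  have hθ1 := h.geomRatio_lt_one
  have hφ := h.phi_lt_half
  have hθe : geomRatio P σ ≤ Real.exp 1 * geomRatio P σ :=
    le_mul_of_one_le_left hθ0 (by have := Real.add_one_le_exp (1 : ℝ); linarith)
  have hlt : geomRatio P σ / (1 - geomRatio P σ) < 1 / 2 :=
    lt_of_le_of_lt (div_le_div_of_nonneg_right hθe (sub_pos.2 hθ1).le) hφ
  rw [div_lt_iff₀ (sub_pos.2 hθ1)] at hlt
  linarith

-- adapted from Cruxes/PolynomialCompression/Disproof.lean (cdisprove), `abs_ratioLimit_sub_one_le`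
/-- **The limit ratio is `1 + O(σ³)`**: `|R - 1| ≤ 4 e θ` (from `R F(R) = 1`, `|F(R) - 1| ≤ eθ/(1-θ)`,
`R ≤ 2` and `1 - θ ≥ 1/2`). [folklore] -/
theorem abs_ratioLimit_sub_one_le {P : DensityProfile} {σ : ℝ} (h : SmallDensity P σ) :
    |ratioLimit P σ - 1| ≤ 4 * Real.exp 1 * geomRatio P σ := by
  have hF := abs_ratioSeries_sub_one_le (P := P) h.σ_pos h.σ_lt_half h.geomRatio_lt_one
    h.abs_ratioLimit_le
  have hspec := (ratioLimit_spec (P := P) h.σ_pos h.σ_lt_half h.geomRatio_lt_one h.phi_lt_half).2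
  have hR0 := h.ratioLimit_pos
  have hR2 := h.ratioLimit_mem.2
  have hθ0 := h.geomRatio_nonneg
  have hθ1 := h.geomRatio_lt_one
  have hθ2 := geomRatio_le_half h
  have heq : ratioLimit P σ - 1 = ratioLimit P σ * (1 - ratioSeries P σ (ratioLimit P σ)) := by
    rw [mul_sub, mul_one, hspec]
  have h1 : |ratioLimit P σ - 1| ≤ 2 * (Real.exp 1 * geomRatio P σ / (1 - geomRatio P σ)) := by
    rw [heq, abs_mul, abs_of_pos hR0, abs_sub_comm]
    exact mul_le_mul hR2 hF (abs_nonneg _) zero_le_two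
  have h2 : Real.exp 1 * geomRatio P σ / (1 - geomRatio P σ) ≤ 2 * (Real.exp 1 * geomRatio P σ) := by
    rw [div_le_iff₀ (by linarith)]
    have hx : 0 ≤ Real.exp 1 * geomRatio P σ * (1 / 2 - geomRatio P σ) :=
      mul_nonneg (mul_nonneg (Real.exp_pos 1).le hθ0) (by linarith)
    nlinarith [hx]
  linarith

-- adapted from Cruxes/PolynomialCompression/Disproof.lean (cdisprove), `abs_rhoLim_sub_ratioLimit_mul_le`
/-- The first cluster coefficient is `γ₁ = 1` (`coefLim_one_zero` with `∫ β = 1`). [folklore] -/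
theorem clusterCoeff_zero {P : DensityProfile} {σ : ℝ} (h : SmallDensity P σ) : clusterCoeff σ 0 = 1 := by
  have h1 := coefLim_one_zero (P := P) h.σ_pos
  rw [coefLim] at h1
  simpa [P.integral_eq_one] using h1

-- adapted from `SmallDensity.abs_rhoLim_term_le` (HardSphereEulerLLN)
/-- The amplitude of the `j`-th term: `|γ_{j+1} R^{j+1}| M^{j+1} ≤ 2 e M θʲ`. [folklore] -/
theorem abs_coeff_mul_pow_le {P : DensityProfile} {σ : ℝ} (h : SmallDensity P σ) (j : ℕ) :
    |clusterCoeff σ j * ratioLimit P σ ^ (j + 1)| * P.M ^ (j + 1) ≤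
      2 * Real.exp 1 * P.M * geomRatio P σ ^ j := by
  have hγ := abs_clusterCoeff_le h.σ_pos h.σ_lt_half j
  have hR0 := h.ratioLimit_pos
  have hR2 := h.ratioLimit_mem.2
  have hM := P.M_pos
  have hv := v₁_pos
  have hσ3 : 0 ≤ σ ^ 3 := pow_nonneg h.σ_pos.le 3
  rw [abs_mul, abs_of_pos (pow_pos hR0 _)]
  calc |clusterCoeff σ j| * ratioLimit P σ ^ (j + 1) * P.M ^ (j + 1)
      ≤ (Real.exp 1 * (Real.exp 1 * (v₁ * σ ^ 3)) ^ j) * 2 ^ (j + 1) * P.M ^ (j + 1) := by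
        gcongr
    _ = 2 * Real.exp 1 * P.M * geomRatio P σ ^ j := by
        rw [geomRatio, ovDensity]; ring

/-- Summability of `j ↦ (j + a)ᵏ rʲ` for `0 < r < 1` (shift of Mathlib's
`summable_pow_mul_geometric_of_norm_lt_one`). [folklore] -/
theorem summable_add_pow_mul_geometric (a k : ℕ) {r : ℝ} (hr0 : 0 < r) (hr1 : r < 1) :
    Summable fun j : ℕ => ((j : ℝ) + a) ^ k * r ^ j := by
  have hn : ‖r‖ < 1 := by rwa [Real.norm_of_nonneg hr0.le]
  have h0 : Summable fun n : ℕ => (n : ℝ) ^ k * r ^ n :=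
    summable_pow_mul_geometric_of_norm_lt_one k hn
  have h : Summable fun j : ℕ => ((j + a : ℕ) : ℝ) ^ k * r ^ (j + a) :=
    (summable_nat_add_iff (f := fun n : ℕ => (n : ℝ) ^ k * r ^ n) a).2 h0
  have h2 : Summable fun j : ℕ => (r ^ a)⁻¹ * (((j + a : ℕ) : ℝ) ^ k * r ^ (j + a)) :=
    h.mul_left ((r ^ a)⁻¹)
  have hra : r ^ a ≠ 0 := pow_ne_zero _ hr0.ne'
  have key : ∀ j : ℕ,
      (r ^ a)⁻¹ * (((j + a : ℕ) : ℝ) ^ k * r ^ (j + a)) = ((j : ℝ) + a) ^ k * r ^ j := by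
    intro j
    rw [Nat.cast_add, pow_add]
    field_simp
  have key' : (fun j : ℕ => (r ^ a)⁻¹ * (((j + a : ℕ) : ℝ) ^ k * r ^ (j + a))) =
      fun j : ℕ => ((j : ℝ) + a) ^ k * r ^ j := funext key
  rw [key'] at h2
  exact h2

/-! ## All lifted derivatives of a smooth torus function, and of its powers -/

/-- **Bounds on all lifted derivatives with prescribed amplitude**: a smooth `f : 𝕋³ → ℝ` with
`|f| ≤ C`, `C > 0`, satisfies `Torus.HasLiftDerivBounds k f C L` for some `L ≥ 1` (every
`Dⁱ (f ∘ proj)` is bounded, `Torus.IsSmooth.eSupNorm_iteratedFDeriv_lift_lt_top`; take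
`L = 1 + ∑_{i ≤ k} sup ‖Dⁱ(f∘proj)‖ / C`). [folklore] -/
theorem exists_hasLiftDerivBounds {f : T3 → ℝ} (hf : Torus.IsSmooth f) {C : ℝ} (hC0 : 0 < C)
    (hC : ∀ x, |f x| ≤ C) (k : ℕ) : ∃ L : ℝ, 1 ≤ L ∧ Torus.HasLiftDerivBounds k f C L := by
  have hD : ∀ i : ℕ, ∃ D : ℝ, ∀ y, ‖iteratedFDeriv ℝ i (Torus.lift f) y‖ ≤ D := fun i =>
    eSupNorm_lt_top_iff.1 (hf.eSupNorm_iteratedFDeriv_lift_lt_top i)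
  choose D hD using hD
  have hsum : 0 ≤ ∑ i ∈ Finset.range (k + 1), |D i| / C :=
    Finset.sum_nonneg fun i _ => div_nonneg (abs_nonneg _) hC0.le
  refine ⟨1 + ∑ i ∈ Finset.range (k + 1), |D i| / C, by linarith, hf, fun i hi y => ?_⟩
  rcases Nat.eq_zero_or_pos i with rfl | hpos
  · rw [pow_zero, mul_one, norm_iteratedFDeriv_zero, Torus.lift_apply, Real.norm_eq_abs]
    exact hC _
  · have hDi : |D i| / C ≤ ∑ i ∈ Finset.range (k + 1), |D i| / C :=
      Finset.single_le_sum (f := fun i => |D i| / C) (fun i _ => div_nonneg (abs_nonneg _) hC0.le)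
        (Finset.mem_range.2 (Nat.lt_succ_of_le hi))
    have hL1 : (1 : ℝ) ≤ 1 + ∑ i ∈ Finset.range (k + 1), |D i| / C := by linarith
    calc ‖iteratedFDeriv ℝ i (Torus.lift f) y‖ ≤ |D i| := (hD i y).trans (le_abs_self _)
      _ = C * (|D i| / C) := by field_simp
      _ ≤ C * (1 + ∑ i ∈ Finset.range (k + 1), |D i| / C) := by gcongr; linarith
      _ ≤ C * (1 + ∑ i ∈ Finset.range (k + 1), |D i| / C) ^ i := by
        gcongr
        exact le_self_pow₀ hL1 hpos.ne'

/-- **Powers**: `HasLiftDerivBounds k f C L` with `L ≥ 0` gives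
`HasLiftDerivBounds k (f^m) (C^m) (m L)` (Leibniz rule, `Torus.HasLiftDerivBounds.mul`, by
induction on `m`). [folklore] -/
theorem hasLiftDerivBounds_pow {k : ℕ} {f : T3 → ℝ} {C L : ℝ} (hf : Torus.HasLiftDerivBounds k f C L)
    (hL : 0 ≤ L) : ∀ m : ℕ, Torus.HasLiftDerivBounds k (fun x => f x ^ m) (C ^ m) (m * L)
  | 0 => by
      have h := Torus.hasLiftDerivBounds_const (d := Fin 3) k (1 : ℝ) (le_refl (0 : ℝ))
      simpa using h
  | m + 1 => by
      have h := (hasLiftDerivBounds_pow hf hL m).mul hf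
      have e1 : (fun x => f x ^ (m + 1)) = fun y => f y ^ m * f y := funext fun x => pow_succ _ _
      rw [e1, pow_succ, Nat.cast_succ, add_mul, one_mul]
      exact h

/-! ## The terms of the lifted series -/

/-- **Derivative bounds for the terms** `T_j = γ_{j+1} R^{j+1} β^{j+1}` of `rhoLim`:
`‖Dᵏ (lift T_j)(y)‖ ≤ 2 e M L ᵏ (j+1)ᵏ θʲ` whenever `HasLiftDerivBounds k β M L`, `L ≥ 1`. [folklore] -/
theorem norm_iteratedFDeriv_term_le {P : DensityProfile} {σ : ℝ} (h : SmallDensity P σ)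
    {k : ℕ} {L : ℝ} (hL1 : 1 ≤ L) (hL : Torus.HasLiftDerivBounds k P.β P.M L) (j : ℕ)
    (y : EuclideanSpace ℝ (Fin 3)) :
    ‖iteratedFDeriv ℝ k
        (Torus.lift fun x => clusterCoeff σ j * ratioLimit P σ ^ (j + 1) * P.β x ^ (j + 1)) y‖ ≤
      2 * Real.exp 1 * P.M * L ^ k * (((j : ℝ) + 1) ^ k * geomRatio P σ ^ j) := by
  have hpow := hasLiftDerivBounds_pow hL (zero_le_one.trans hL1) (j + 1)
  have hterm := hpow.const_mul (clusterCoeff σ j * ratioLimit P σ ^ (j + 1))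
  have hb := hterm.bound le_rfl y
  refine hb.trans ?_
  have hc := abs_coeff_mul_pow_le h j
  have hθ0 := h.geomRatio_nonneg
  rw [Nat.cast_succ, mul_pow]
  calc |clusterCoeff σ j * ratioLimit P σ ^ (j + 1)| * P.M ^ (j + 1) * (((j : ℝ) + 1) ^ k * L ^ k)
      ≤ (2 * Real.exp 1 * P.M * geomRatio P σ ^ j) * (((j : ℝ) + 1) ^ k * L ^ k) :=
        mul_le_mul_of_nonneg_right hc (by positivity)
    _ = 2 * Real.exp 1 * P.M * L ^ k * (((j : ℝ) + 1) ^ k * geomRatio P σ ^ j) := by ring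

/-- **Smoothness and the `Cⁿ` rate for a general smooth profile.** If `SmallDensity P σ`, `β = P.β`
is smooth and `HasLiftDerivBounds k β M L_k` (`L_k ≥ 1`) for every `k`, then `rhoLim P σ` is smooth
and `‖Dⁿ lift(rhoLim P σ - β)(y)‖ ≤ 2 e M L_nⁿ (2 + ∑_j (j+2)ⁿ 2^{-j}) θ` (termwise differentiation
of `∑_j T_j`, Mathlib `contDiff_tsum` / `iteratedFDeriv_tsum_apply`; zeroth term `R β` with
`|R - 1| ≤ 4eθ`, tail with `θʲ⁺¹ ≤ θ 2^{-j}`). [folklore] -/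
theorem isSmooth_rhoLim_and_rate {P : DensityProfile} {σ : ℝ} (h : SmallDensity P σ)
    (hβ : Torus.IsSmooth P.β) {L : ℕ → ℝ} (hL1 : ∀ k, 1 ≤ L k)
    (hL : ∀ k, Torus.HasLiftDerivBounds k P.β P.M (L k)) :
    Torus.IsSmooth (rhoLim P σ) ∧
      ∀ (n : ℕ) (y : EuclideanSpace ℝ (Fin 3)),
        ‖iteratedFDeriv ℝ n (Torus.lift fun x => rhoLim P σ x - P.β x) y‖ ≤
          2 * Real.exp 1 * P.M * L n ^ n *
            (2 + ∑' j : ℕ, ((j : ℝ) + 2) ^ n * (1 / 2 : ℝ) ^ j) * geomRatio P σ := by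
  have hθ0 : 0 ≤ geomRatio P σ := h.geomRatio_nonneg
  have hθpos : 0 < geomRatio P σ := geomRatio_pos h
  have hθ1 : geomRatio P σ < 1 := h.geomRatio_lt_one
  have hθ2 : geomRatio P σ ≤ 1 / 2 := geomRatio_le_half h
  have hM : 0 < P.M := P.M_pos
  -- the terms of the lifted series and their bounds
  set T : ℕ → EuclideanSpace ℝ (Fin 3) → ℝ := fun j =>
    Torus.lift fun x => clusterCoeff σ j * ratioLimit P σ ^ (j + 1) * P.β x ^ (j + 1) with hT
  set v : ℕ → ℕ → ℝ := fun k j =>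
    2 * Real.exp 1 * P.M * L k ^ k * (((j : ℝ) + 1) ^ k * geomRatio P σ ^ j) with hv
  have hTs : ∀ j, ContDiff ℝ ∞ (T j) := fun j =>
    ((hasLiftDerivBounds_pow (hL 0) (zero_le_one.trans (hL1 0)) (j + 1)).const_mul
      (clusterCoeff σ j * ratioLimit P σ ^ (j + 1))).isSmooth
  have hTv : ∀ (k j : ℕ) (y : EuclideanSpace ℝ (Fin 3)), ‖iteratedFDeriv ℝ k (T j) y‖ ≤ v k j :=
    fun k j y => norm_iteratedFDeriv_term_le h (hL1 k) (hL k) j y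
  have hvs : ∀ k, Summable (v k) := fun k => by
    have hs : Summable fun j : ℕ => ((j : ℝ) + 1) ^ k * geomRatio P σ ^ j := by
      simpa using summable_add_pow_mul_geometric 1 k hθpos hθ1
    exact hs.mul_left _
  have hlift : Torus.lift (rhoLim P σ) = fun y => ∑' j, T j y := rfl
  have hsmooth : ContDiff ℝ ∞ fun y => ∑' j, T j y :=
    contDiff_tsum (N := (⊤ : ℕ∞)) hTs (fun k _ => hvs k) fun k j y _ => hTv k j y
  refine ⟨?_, fun n y => ?_⟩
  · show ContDiff ℝ ∞ (Torus.lift (rhoLim P σ))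
    rw [hlift]
    exact hsmooth
  -- termwise differentiation
  have hD : iteratedFDeriv ℝ n (fun y => ∑' j, T j y) y = ∑' j, iteratedFDeriv ℝ n (T j) y :=
    iteratedFDeriv_tsum_apply (N := (⊤ : ℕ∞)) hTs (fun k _ => hvs k) (fun k j y _ => hTv k j y)
      (by exact_mod_cast le_top) y
  have hsum : Summable fun j => iteratedFDeriv ℝ n (T j) y :=
    Summable.of_norm_bounded (hvs n) fun j => hTv n j y
  -- the zeroth term is `R • lift β`
  have hT0 : T 0 = fun y => ratioLimit P σ • Torus.lift P.β y := by
    funext y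
    simp only [hT, Torus.lift_apply, smul_eq_mul]
    rw [clusterCoeff_zero h]
    ring
  have hβn : ContDiff ℝ n (Torus.lift P.β) := hβ.of_le (by exact_mod_cast le_top)
  have hD0 : iteratedFDeriv ℝ n (T 0) y = ratioLimit P σ • iteratedFDeriv ℝ n (Torus.lift P.β) y := by
    rw [hT0]
    exact iteratedFDeriv_const_smul_apply' hβn.contDiffAt
  -- split off the zeroth term
  have hsub : (Torus.lift fun x => rhoLim P σ x - P.β x) = (fun y => ∑' j, T j y) - Torus.lift P.β :=
    rfl
  have hsn : ContDiff ℝ n (fun y => ∑' j, T j y) := hsmooth.of_le (by exact_mod_cast le_top)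
  rw [hsub, iteratedFDeriv_sub_apply hsn.contDiffAt hβn.contDiffAt, hD, hsum.tsum_eq_zero_add, hD0]
  -- the bounds
  have hDb : ‖iteratedFDeriv ℝ n (Torus.lift P.β) y‖ ≤ P.M * L n ^ n := (hL n).bound le_rfl y
  have hR : |ratioLimit P σ - 1| ≤ 4 * Real.exp 1 * geomRatio P σ := abs_ratioLimit_sub_one_le h
  have hS : Summable fun j : ℕ => ((j : ℝ) + 2) ^ n * (1 / 2 : ℝ) ^ j := by
    simpa using summable_add_pow_mul_geometric 2 n (by norm_num : (0 : ℝ) < 1 / 2) (by norm_num)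
  have hLn : 0 ≤ L n ^ n := pow_nonneg (zero_le_one.trans (hL1 n)) n
  have htail : ‖∑' j, iteratedFDeriv ℝ n (T (j + 1)) y‖ ≤
      2 * Real.exp 1 * P.M * L n ^ n * geomRatio P σ *
        ∑' j : ℕ, ((j : ℝ) + 2) ^ n * (1 / 2 : ℝ) ^ j := by
    refine tsum_of_norm_bounded
      (hS.hasSum.mul_left (2 * Real.exp 1 * P.M * L n ^ n * geomRatio P σ)) fun j => ?_
    refine (hTv n (j + 1) y).trans ?_
    have hj : ((j + 1 : ℕ) : ℝ) + 1 = (j : ℝ) + 2 := by push_cast; ring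
    have hpow : geomRatio P σ ^ (j + 1) ≤ geomRatio P σ * (1 / 2 : ℝ) ^ j := by
      rw [pow_succ']
      exact mul_le_mul_of_nonneg_left (pow_le_pow_left₀ hθ0 hθ2 j) hθ0
    show 2 * Real.exp 1 * P.M * L n ^ n * ((((j + 1 : ℕ) : ℝ) + 1) ^ n * geomRatio P σ ^ (j + 1)) ≤
      2 * Real.exp 1 * P.M * L n ^ n * geomRatio P σ * (((j : ℝ) + 2) ^ n * (1 / 2 : ℝ) ^ j)
    rw [hj]
    calc 2 * Real.exp 1 * P.M * L n ^ n * (((j : ℝ) + 2) ^ n * geomRatio P σ ^ (j + 1))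
        ≤ 2 * Real.exp 1 * P.M * L n ^ n * (((j : ℝ) + 2) ^ n * (geomRatio P σ * (1 / 2 : ℝ) ^ j)) := by
          gcongr
      _ = 2 * Real.exp 1 * P.M * L n ^ n * geomRatio P σ * (((j : ℝ) + 2) ^ n * (1 / 2 : ℝ) ^ j) := by
          ring
  calc ‖ratioLimit P σ • iteratedFDeriv ℝ n (Torus.lift P.β) y +
          ∑' j, iteratedFDeriv ℝ n (T (j + 1)) y - iteratedFDeriv ℝ n (Torus.lift P.β) y‖
      = ‖(ratioLimit P σ - 1) • iteratedFDeriv ℝ n (Torus.lift P.β) y +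
          ∑' j, iteratedFDeriv ℝ n (T (j + 1)) y‖ := by
        congr 1
        rw [sub_smul, one_smul]
        abel
    _ ≤ |ratioLimit P σ - 1| * ‖iteratedFDeriv ℝ n (Torus.lift P.β) y‖ +
          ‖∑' j, iteratedFDeriv ℝ n (T (j + 1)) y‖ := by
        refine (norm_add_le _ _).trans ?_
        rw [norm_smul, Real.norm_eq_abs]
    _ ≤ 4 * Real.exp 1 * geomRatio P σ * (P.M * L n ^ n) +
          2 * Real.exp 1 * P.M * L n ^ n * geomRatio P σ *
            ∑' j : ℕ, ((j : ℝ) + 2) ^ n * (1 / 2 : ℝ) ^ j :=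
        add_le_add (mul_le_mul hR hDb (norm_nonneg _) (by positivity)) htail
    _ = 2 * Real.exp 1 * P.M * L n ^ n *
            (2 + ∑' j : ℕ, ((j : ℝ) + 2) ^ n * (1 / 2 : ℝ) ^ j) * geomRatio P σ := by ring

end StaticsSmoothRate

open StaticsSmoothRate in
/-- **Smoothness and the `Cⁿ` rate of the smooth statics** (stub `stub_staticsSmoothRate` of the line
`log-lipschitz-budget`, crux `ImplosionDichotomy.PolynomialCompression`). For a smooth positive activity
`a₀`: whenever `SmallDensity (profileOf a₀) σ` holds, `rhoLim (profileOf a₀) σ` is smooth on `𝕋³`, and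
for every `n` there is `Cₙ = Cₙ(a₀)` with `‖Dⁿ lift(rhoLim (profileOf a₀) σ − a₀/∫a₀)(y)‖ ≤ Cₙ σ³` for
all such `σ` and all `y ∈ ℝ³`. [folklore] -/
theorem stub_staticsSmoothRate :
    ∀ (a₀ : T3 → ℝ) (ha : Torus.IsSmooth a₀) (ha0 : ∀ x, 0 < a₀ x),
      (∀ σ : ℝ, SmallDensity (profileOf a₀ ha.continuous ha0) σ →
          Torus.IsSmooth (rhoLim (profileOf a₀ ha.continuous ha0) σ)) ∧
      ∀ n : ℕ, ∃ Cn : ℝ, ∀ σ : ℝ, SmallDensity (profileOf a₀ ha.continuous ha0) σ →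
        ∀ y : EuclideanSpace ℝ (Fin 3),
          ‖iteratedFDeriv ℝ n
              (Torus.lift (fun x => rhoLim (profileOf a₀ ha.continuous ha0) σ x - a₀ x / ∫ z, a₀ z)) y‖ ≤
            Cn * σ ^ 3 := by
  intro a₀ ha ha0
  set P : DensityProfile := profileOf a₀ ha.continuous ha0 with hP
  -- the profile `β = a₀ / ∫ a₀` is smooth, with all lifted derivatives bounded
  have hβ : Torus.IsSmooth P.β := by
    show ContDiff ℝ ∞ fun y => Torus.lift a₀ y / ∫ z, a₀ z
    exact ha.div_const _
  have hM : 0 < P.M := P.M_pos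
  have hLex : ∀ k, ∃ L : ℝ, 1 ≤ L ∧ Torus.HasLiftDerivBounds k P.β P.M L := fun k =>
    exists_hasLiftDerivBounds hβ hM (fun x => by rw [abs_of_pos (P.pos x)]; exact P.le_M x) k
  choose L hL1 hL using hLex
  refine ⟨fun σ hσ => (isSmooth_rhoLim_and_rate hσ hβ hL1 hL).1, fun n => ?_⟩
  refine ⟨2 * Real.exp 1 * P.M * L n ^ n * (2 + ∑' j : ℕ, ((j : ℝ) + 2) ^ n * (1 / 2 : ℝ) ^ j) *
    (2 * Real.exp 1 * (P.M * v₁)), fun σ hσ y => ?_⟩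
  have h := (isSmooth_rhoLim_and_rate hσ hβ hL1 hL).2 n y
  have hθ : geomRatio P σ = 2 * Real.exp 1 * (P.M * v₁) * σ ^ 3 := by
    rw [geomRatio, ovDensity]; ring
  rw [hθ] at h
  calc ‖iteratedFDeriv ℝ n (Torus.lift fun x => rhoLim P σ x - a₀ x / ∫ z, a₀ z) y‖
      = ‖iteratedFDeriv ℝ n (Torus.lift fun x => rhoLim P σ x - P.β x) y‖ := rfl
    _ ≤ _ := h
    _ = _ := by ring

end Summit.AtomisticToContinuum.HydrodynamicLimit.Theorems
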